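import Summits.QuantumFields.QCD.Theorems.QuarksAsStableActionStableActionBridgeSoftClosureQCD
import HarnessLib

/-!
# Soft OS closure VI: ASYMPTOTIC package — `Λ k` only asymptotic to the statement's lattice functional

Support file for crux `QuarksAsStableAction.StableActionBridge` (item stmt-QuantumFields-9737), line `Sketch` (reshape r3e,
lead c16).  The landed closure II (`exists_osData_qcd_of_package`) asks the functionals `Λ k` to BE `qcdLatticeSchwinger` on
real tensors; the r3e package lives on the thermal, Θ-symmetrised functional (`qcdLatticeDistSymAP`), which is only
asymptotic to it.  Two hypotheses change, nothing else:

* (P0′) `Λ k n σ (⊗fᵢ) − qcdLatticeSchwinger sch k n σ f → 0` on off-diagonal real tensors (`n ≥ 1`);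
* (P10′) `ClustersCS 4 (Λ read on the canonical tensor witnesses) Δ` instead of `sch.HasSpeciesCSClustering Δ`; the
  continuum gap is `OSData.hasMassGap_of_clustersCS` (generic in the approximating functional).

Theorems: `exists_osData_qcd_of_asymptoticPackage`, `qcdOf_of_asymptoticPackage`.
References: Osterwalder–Schrader II (1975) §2, §4; Glimm–Jaffe 1987 §6.1; Jaffe–Witten 2000 §5.
-/

noncomputable section

open Filter Topology ComplexConjugate
open scoped SchwartzMap
open Literature.MathematicalPhysics.AQFT Literature.MathematicalPhysics.QuantumLattice
open Literature.MathematicalPhysics.QuantumFieldTheory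

namespace Summit.QuantumFields.QCD.Cruxes.StableActionBridge.Sketch

/-- **Asymptotic agreement transfers tensor convergence**: if `Λ k → S` on `⁰𝒮` and `Λ k − qcdLatticeSchwinger sch k → 0`
on off-diagonal real tensors (`n ≥ 1`), then the statement's lattice `n`-point functions converge to `S` there — the
convergence datum of `IsQCDAlong`. [cite: OsterwalderSchraderCMP1975, §4] -/
theorem tendsto_qcdLatticeSchwinger_of_asymptotic :
    ∀ {Nf : ℕ} (sch : QCDScheme Nf) (Λ : ℕ → LabelledSchwingerFamily (QCDField Nf) (EuclideanSpace ℝ (Fin 4))) (S : LabelledSchwingerFamily (QCDField Nf) (EuclideanSpace ℝ (Fin 4))), (∀ (n : ℕ) (σ : Fin n → QCDField Nf) (F : 𝓢((Fin n → (EuclideanSpace ℝ (Fin 4))), ℂ)), IsOffDiagonal F → Tendsto (fun k => Λ k n σ F) atTop (𝓝 (S n σ F))) → (∀ n : ℕ, n ≠ 0 → ∀ (σ : Fin n → QCDField Nf) (f : Fin n → 𝓢(EuclideanSpace ℝ (Fin 4), ℝ)) (F : 𝓢((Fin n → (EuclideanSpace ℝ (Fin 4))), ℂ)), IsTensorOf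 F (fun i => ofRealTest (f i)) → IsOffDiagonal F → Tendsto (fun k => Λ k n σ F - qcdLatticeSchwinger sch k n σ f) atTop (𝓝 0)) → ∀ n : ℕ, n ≠ 0 → ∀ (σ : Fin n → QCDField Nf) (f : Fin n → 𝓢(EuclideanSpace ℝ (Fin 4), ℝ)) (F : 𝓢((Fin n → (EuclideanSpace ℝ (Fin 4))), ℂ)), IsTensorOf F (fun i => ofRealTest (f i)) → IsOffDiagonal F → Tendsto (fun k => qcdLatticeSchwinger sch k n σ f) atTop (𝓝 (S n σ F)) := by
  intro Nf sch Λ S hS hagree n hn σ f F hF hoff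
  have h := (hS n σ F hoff).sub (hagree n hn σ f F hF hoff)
  simp only [sub_sub_cancel, sub_zero] at h
  exact h

/-- **OS data of QCD along one scheme from an ASYMPTOTIC lattice package and the rotation module.**  As the landed
`exists_osData_qcd_of_package`, but (P0′) the functionals `Λ k` need only be asymptotic to the statement's lattice
`n`-point functions on off-diagonal real tensors, and (P10′) the Cauchy–Schwarz clustering is asked of `Λ` itself (the
continuum gap then comes from the generic transfer `OSData.hasMassGap_of_clustersCS`).  This is the closure consumed by a
package read on a DIFFERENT lattice functional than the statement's (thermal boundary condition, symmetrised
insertions), tied to it by one comparison clause. [cite: OsterwalderSchraderCMP1975, §2, §4] -/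
theorem exists_osData_qcd_of_asymptoticPackage {Nf : ℕ} (sch : QCDScheme Nf)
    (Λ : ℕ → LabelledSchwingerFamily (QCDField Nf) (EuclideanSpace ℝ (Fin 4)))
    -- (P0′) `Λ k` is ASYMPTOTICALLY the lattice `n`-point function of the scheme on off-diagonal real tensors, `n ≥ 1`
    (hagree : ∀ n : ℕ, n ≠ 0 → ∀ (σ : Fin n → QCDField Nf) (f : Fin n → 𝓢(EuclideanSpace ℝ (Fin 4), ℝ))
      (F : 𝓢((Fin n → (EuclideanSpace ℝ (Fin 4))), ℂ)), IsTensorOf F (fun i => ofRealTest (f i)) → IsOffDiagonal F →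
      Tendsto (fun k => Λ k n σ F - qcdLatticeSchwinger sch k n σ f) atTop (𝓝 0))
    -- (P1) asymptotic scaling and physical branch
    (hAS : sch.HasAsymptoticScaling) (hbr : ∀ fl : Fin Nf, ∀ᶠ k in atTop, -1 < sch.mq fl k)
    -- (P2) k-uniform E0′ bound on `⁰𝒮`
    {s : ℕ} {α β : ℝ} (hα : 0 ≤ α)
    (hbound : ∀ (n : ℕ) (σ : Fin n → QCDField Nf), ∀ᶠ k in atTop, ∀ F : 𝓢((Fin n → (EuclideanSpace ℝ (Fin 4))), ℂ),
      IsOffDiagonal F → ‖Λ k n σ F‖ ≤ α * (n.factorial : ℝ) ^ β * schwartzNorm (n * s) F)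
    -- (P3) convergence on `⁰𝒮` along the full sequence
    (hconv : ∀ (n : ℕ) (σ : Fin n → QCDField Nf) (F : 𝓢((Fin n → (EuclideanSpace ℝ (Fin 4))), ℂ)), IsOffDiagonal F →
      ∃ c : ℂ, Tendsto (fun k => Λ k n σ F) atTop (𝓝 c))
    -- (P4) eventual normalisation
    (hnorm : ∀ᶠ k in atTop, (Λ k).IsNormalized)
    -- (P6) asymptotic translation invariance on `⁰𝒮`
    (htrans : ∀ (n : ℕ) (σ : Fin n → QCDField Nf) (a : (EuclideanSpace ℝ (Fin 4))) (F : 𝓢((Fin n → (EuclideanSpace ℝ (Fin 4))), ℂ)), IsOffDiagonal F →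
      Tendsto (fun k => Λ k n σ (translateMulti a F) - Λ k n σ F) atTop (𝓝 0))
    -- (P7) asymptotic permutation symmetry on `⁰𝒮`
    (hsymm : ∀ (n : ℕ) (σ : Fin n → QCDField Nf) (π : Equiv.Perm (Fin n)) (F : 𝓢((Fin n → (EuclideanSpace ℝ (Fin 4))), ℂ)),
      IsOffDiagonal F → Tendsto (fun k => Λ k n σ (permTest π F) - Λ k n (σ ∘ π) F) atTop (𝓝 0))
    -- (P8) eventually approximately positive OS forms
    (hrp : ∀ (N : ℕ) (deg : Fin N → ℕ) (lab : (j : Fin N) → Fin (deg j) → QCDField Nf)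
      (F : (j : Fin N) → 𝓢((Fin (deg j) → (EuclideanSpace ℝ (Fin 4))), ℂ)), (∀ j, IsTimeOrdered (F j)) →
      ∀ H : (i j : Fin N) → 𝓢((Fin (deg i + deg j) → (EuclideanSpace ℝ (Fin 4))), ℂ),
        (∀ i j, IsAppendTensorOf (H i j) (osAdjoint (F i)) (F j)) →
        ∀ ε : ℝ, 0 < ε → ∀ᶠ l in atTop,
          -ε ≤ (∑ i, ∑ j, Λ l (deg i + deg j) (Fin.append (lab i ∘ Fin.rev) (lab j)) (H i j)).re ∧
          |(∑ i, ∑ j, Λ l (deg i + deg j) (Fin.append (lab i ∘ Fin.rev) (lab j)) (H i j)).im| ≤ ε)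
    -- (P9) k-uniform spatial clustering
    (hcl : ∀ (n m : ℕ) (σ : Fin n → QCDField Nf) (σ' : Fin m → QCDField Nf) (F : 𝓢((Fin n → (EuclideanSpace ℝ (Fin 4))), ℂ))
      (G : 𝓢((Fin m → (EuclideanSpace ℝ (Fin 4))), ℂ)), IsTimeOrdered F → IsTimeOrdered G → ∀ a : (EuclideanSpace ℝ (Fin 4)), a 0 = 0 → a ≠ 0 →
      ∀ ε : ℝ, 0 < ε → ∃ t₀ : ℝ, ∀ t : ℝ, t₀ ≤ t → ∀ H : 𝓢((Fin (n + m) → (EuclideanSpace ℝ (Fin 4))), ℂ),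
        IsAppendTensorOf H (osAdjoint F) (translateMulti (t • a) G) →
        ∀ᶠ k in atTop, ‖Λ k (n + m) (Fin.append (σ ∘ Fin.rev) σ') H -
          Λ k n (σ ∘ Fin.rev) (osAdjoint F) * Λ k m σ' G‖ ≤ ε)
    -- (P10′) Cauchy–Schwarz clustering OF `Λ` (read on the canonical real tensor witnesses) and the uniform lattice gap, one rate
    {Δ : ℝ} (hCS : ClustersCS 4 (fun k n σ f => Λ k n σ (SchwartzMap.tensorFin n fun i => ofRealTest (f i))) Δ)
    (hgap : sch.HasLatticeMassGap Δ)
    -- (P11) eventual lower bounds: glue and flavour-changing pseudoscalar two-point functions, glue `κ₃`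
    (hglue : ∃ (F G : 𝓢((Fin 1 → (EuclideanSpace ℝ (Fin 4))), ℂ)) (H : 𝓢((Fin (1 + 1) → (EuclideanSpace ℝ (Fin 4))), ℂ)),
      IsTimeOrdered F ∧ IsTimeOrdered G ∧ IsAppendTensorOf H (osAdjoint F) G ∧ ∃ ε : ℝ, 0 < ε ∧
        ∀ᶠ k in atTop, ε ≤ ‖Λ k (1 + 1) (fun _ => QCDField.glue) H -
          Λ k 1 (fun _ => QCDField.glue) (osAdjoint F) * Λ k 1 (fun _ => QCDField.glue) G‖)
    (hpseudo : ∀ f g : Fin Nf, f ≠ g → ∃ (F G : 𝓢((Fin 1 → (EuclideanSpace ℝ (Fin 4))), ℂ)) (H : 𝓢((Fin (1 + 1) → (EuclideanSpace ℝ (Fin 4))), ℂ)),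
      IsTimeOrdered F ∧ IsTimeOrdered G ∧ IsAppendTensorOf H (osAdjoint F) G ∧ ∃ ε : ℝ, 0 < ε ∧
        ∀ᶠ k in atTop, ε ≤ ‖Λ k (1 + 1) (fun _ => QCDField.pseudoRe f g) H -
          Λ k 1 (fun _ => QCDField.pseudoRe f g) (osAdjoint F) *
            Λ k 1 (fun _ => QCDField.pseudoRe f g) G‖)
    (hκ₃ : ∃ (f g h : 𝓢(EuclideanSpace ℝ (Fin 4), ℂ)) (Ffgh : 𝓢((Fin 3 → (EuclideanSpace ℝ (Fin 4))), ℂ)) (Fgh Ffh Ffg : 𝓢((Fin 2 → (EuclideanSpace ℝ (Fin 4))), ℂ))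
      (Ff Fg Fh : 𝓢((Fin 1 → (EuclideanSpace ℝ (Fin 4))), ℂ)),
      IsTensorOf Ffgh ![f, g, h] ∧ IsOffDiagonal Ffgh ∧ IsTensorOf Fgh ![g, h] ∧ IsTensorOf Ffh ![f, h] ∧
      IsTensorOf Ffg ![f, g] ∧ IsOffDiagonal Fgh ∧ IsOffDiagonal Ffh ∧ IsOffDiagonal Ffg ∧
      IsTensorOf Ff ![f] ∧ IsTensorOf Fg ![g] ∧ IsTensorOf Fh ![h] ∧ ∃ ε : ℝ, 0 < ε ∧
        ∀ᶠ k in atTop, ε ≤ ‖Λ k 3 (fun _ => QCDField.glue) Ffgh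
          - Λ k 1 (fun _ => QCDField.glue) Ff * Λ k 2 (fun _ => QCDField.glue) Fgh
          - Λ k 1 (fun _ => QCDField.glue) Fg * Λ k 2 (fun _ => QCDField.glue) Ffh
          - Λ k 1 (fun _ => QCDField.glue) Fh * Λ k 2 (fun _ => QCDField.glue) Ffg
          + 2 * (Λ k 1 (fun _ => QCDField.glue) Ff * Λ k 1 (fun _ => QCDField.glue) Fg *
              Λ k 1 (fun _ => QCDField.glue) Fh)‖)
    -- the E1 (rotation) module for this scheme
    (hrot : ∀ S : LabelledSchwingerFamily (QCDField Nf) (EuclideanSpace ℝ (Fin 4)),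
      (∀ n : ℕ, n ≠ 0 → ∀ (σ : Fin n → QCDField Nf) (f : Fin n → 𝓢(EuclideanSpace ℝ (Fin 4), ℝ)) (F : 𝓢((Fin n → (EuclideanSpace ℝ (Fin 4))), ℂ)),
        IsTensorOf F (fun i => ofRealTest (f i)) → IsOffDiagonal F →
        Tendsto (fun k => qcdLatticeSchwinger sch k n σ f) atTop (𝓝 (S n σ F))) →
      ∀ (n : ℕ) (σ : Fin n → QCDField Nf) (R : (EuclideanSpace ℝ (Fin 4)) ≃ₗᵢ[ℝ] (EuclideanSpace ℝ (Fin 4))),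
        LinearMap.det (R.toLinearEquiv : (EuclideanSpace ℝ (Fin 4)) →ₗ[ℝ] (EuclideanSpace ℝ (Fin 4))) = 1 →
        ∀ F : 𝓢((Fin n → (EuclideanSpace ℝ (Fin 4))), ℂ), IsOffDiagonal F → S n σ (linActMulti R F) = S n σ F) :
    ∃ T : OSData (QCDField Nf) 4, IsQCDAlong sch T ∧ T.IsNontrivial QCDField.glue ∧
      T.IsNonGaussian QCDField.glue ∧ (∀ f g : Fin Nf, f ≠ g → T.IsNontrivial (QCDField.pseudoRe f g)) ∧
      T.HasMassGap Δ ∧ sch.HasLatticeMassGap Δ := by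
  -- the limit family on `⁰𝒮`, with the E0′ bound everywhere
  obtain ⟨S, hS, hSb⟩ := exists_labelled_tendsto Λ (fun n => α * (n.factorial : ℝ) ^ β) (fun n => n * s)
    (fun n => by positivity) hbound hconv
  -- lattice tensors converge to `S`
  have htensor : ∀ n : ℕ, n ≠ 0 → ∀ (σ : Fin n → QCDField Nf) (f : Fin n → 𝓢(EuclideanSpace ℝ (Fin 4), ℝ))
      (F : 𝓢((Fin n → (EuclideanSpace ℝ (Fin 4))), ℂ)), IsTensorOf F (fun i => ofRealTest (f i)) → IsOffDiagonal F →
      Tendsto (fun k => qcdLatticeSchwinger sch k n σ f) atTop (𝓝 (S n σ F)) := by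
    exact tendsto_qcdLatticeSchwinger_of_asymptotic sch Λ S hS hagree
  -- the axioms of `S`
  have h0 : S.IsNormalized := isNormalized_of_labelled_tendsto hS hnorm
  have hE0' : S.HasLinearGrowth :=
    hasLinearGrowth_of_labelled_bound S s α β fun n k F _ => hSb n k F
  have hE1t : ∀ (n : ℕ) (σ : Fin n → QCDField Nf) (a : (EuclideanSpace ℝ (Fin 4))) (F : 𝓢((Fin n → (EuclideanSpace ℝ (Fin 4))), ℂ)), IsOffDiagonal F →
      S n σ (translateMulti a F) = S n σ F := translate_eq_of_labelled_tendsto hS htrans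
  have hE1r := hrot S htensor
  have hE2 : S.IsReflectionPositive := isReflectionPositive_of_labelled_tendsto hS hrp
  -- E0-hermiticity is a consequence of E2 and E0-normalisation (Kravchuk–Qiao–Rychkov Rem. 2.2; tree, YM OSLegsC)
  have h0' : S.IsHermitian :=
    Summit.QuantumFields.YangMills.Cruxes.ContinuumLimitOnTrajectory.TwoOrbitSynchronisation.osLegsC_isHermitian_of_isReflectionPositive
      S hE2 h0
  have hE3 : S.IsSymmetric := isSymmetric_of_labelled_tendsto hS hsymm
  have hE4 : S.HasClusterProperty := hasClusterProperty_of_labelled_tendsto hS hcl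
  obtain ⟨T, hTS⟩ := exists_osData_of_axioms S h0 h0' hE0' hE1t hE1r hE2 hE3 hE4
  -- convergence read on `T`
  have hST : ∀ (n : ℕ) (σ : Fin n → QCDField Nf) (F : 𝓢((Fin n → (EuclideanSpace ℝ (Fin 4))), ℂ)), IsOffDiagonal F →
      Tendsto (fun k => Λ k n σ F) atTop (𝓝 (T.schwinger n σ F)) := by
    intro n σ F hF; rw [hTS]; exact hS n σ F hF
  have hQCD : IsQCDAlong sch T := by
    refine ⟨hAS, hbr, fun n hn σ f F hF hoff => ?_⟩
    rw [hTS]; exact htensor n hn σ f F hF hoff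
  -- the continuum gap from the Cauchy–Schwarz clustering of `Λ` itself (generic transfer)
  have hΛT : ∀ (n : ℕ), n ≠ 0 → ∀ (σ : Fin n → QCDField Nf) (f : Fin n → 𝓢(EuclideanSpace ℝ (Fin 4), ℝ))
      (F : 𝓢((Fin n → (EuclideanSpace ℝ (Fin 4))), ℂ)), IsTensorOf F (fun i => ofRealTest (f i)) →
      IsOffDiagonal F → Tendsto (fun k => Λ k n σ (SchwartzMap.tensorFin n fun i => ofRealTest (f i))) atTop
        (𝓝 (T.schwinger n σ F)) := by
    intro n _ σ f F hF hoff
    rw [(isTensorOf_tensorFin fun i => ofRealTest (f i)).unique hF]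
    exact hST n σ F hoff
  refine ⟨T, hQCD, ?_, ?_, ?_, OSData.hasMassGap_of_clustersCS T (by norm_num) _ hΛT hCS, hgap⟩
  · obtain ⟨F, G, H, hF, hG, hH, ε, hε, hev⟩ := hglue
    exact isNontrivial_of_labelled_tendsto T hST F G H hF hG hH hε hev
  · obtain ⟨f, g, h, Ffgh, Fgh, Ffh, Ffg, Ff, Fg, Fh, h3, h3o, hgh, hfh, hfg, hgho, hfho, hfgo, hf, hg, hh,
      ε, hε, hev⟩ := hκ₃
    exact isNonGaussian_of_labelled_tendsto T hST f g h Ffgh Fgh Ffh Ffg Ff Fg Fh h3 h3o hgh hfh hfg hgho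
      hfho hfgo hf hg hh hε hev
  · intro f g hfg
    obtain ⟨F, G, H, hF, hG, hH, ε, hε, hev⟩ := hpseudo f g hfg
    exact isNontrivial_of_labelled_tendsto T hST F G H hF hG hH hε hev

/-- **`QCDOf N_f` from an asymptotic lattice package and the rotation module** — `qcdOf_of_package` with (P0′)
asymptotic agreement and (P10′) Cauchy–Schwarz clustering of `Λ`; quantified exactly as the conjunct. [cite: JaffeWitten2000, §5] -/
theorem qcdOf_of_asymptoticPackage :
    ∀ {Nf : ℕ},
    (∃ reg : QCDRegularisation Nf, reg.HasMassScaling ∧ reg.IsChiralAtZero ∧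
      ∀ m : Fin Nf → ℝ, (∀ f, 0 < m f) → ∃ (z shift : QCDField Nf → ℕ → ℝ)
        (Λ : ℕ → LabelledSchwingerFamily (QCDField Nf) (EuclideanSpace ℝ (Fin 4))),
        (∀ n : ℕ, n ≠ 0 → ∀ (σ : Fin n → QCDField Nf) (f : Fin n → 𝓢(EuclideanSpace ℝ (Fin 4), ℝ))
          (F : 𝓢((Fin n → (EuclideanSpace ℝ (Fin 4))), ℂ)), IsTensorOf F (fun i => ofRealTest (f i)) → IsOffDiagonal F →
          Tendsto (fun k => Λ k n σ F - qcdLatticeSchwinger (reg.scheme m z shift) k n σ f) atTop (𝓝 0)) ∧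
        (reg.scheme m z shift).HasAsymptoticScaling ∧
        (∀ fl : Fin Nf, ∀ᶠ k in atTop, -1 < (reg.scheme m z shift).mq fl k) ∧
        (∃ (s : ℕ) (α β : ℝ), 0 ≤ α ∧ ∀ (n : ℕ) (σ : Fin n → QCDField Nf), ∀ᶠ k in atTop,
          ∀ F : 𝓢((Fin n → (EuclideanSpace ℝ (Fin 4))), ℂ), IsOffDiagonal F →
            ‖Λ k n σ F‖ ≤ α * (n.factorial : ℝ) ^ β * schwartzNorm (n * s) F) ∧
        (∀ (n : ℕ) (σ : Fin n → QCDField Nf) (F : 𝓢((Fin n → (EuclideanSpace ℝ (Fin 4))), ℂ)), IsOffDiagonal F →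
          ∃ c : ℂ, Tendsto (fun k => Λ k n σ F) atTop (𝓝 c)) ∧
        (∀ᶠ k in atTop, (Λ k).IsNormalized) ∧
        (∀ (n : ℕ) (σ : Fin n → QCDField Nf) (a : (EuclideanSpace ℝ (Fin 4))) (F : 𝓢((Fin n → (EuclideanSpace ℝ (Fin 4))), ℂ)), IsOffDiagonal F →
          Tendsto (fun k => Λ k n σ (translateMulti a F) - Λ k n σ F) atTop (𝓝 0)) ∧
        (∀ (n : ℕ) (σ : Fin n → QCDField Nf) (π : Equiv.Perm (Fin n)) (F : 𝓢((Fin n → (EuclideanSpace ℝ (Fin 4))), ℂ)),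
          IsOffDiagonal F →
          Tendsto (fun k => Λ k n σ (permTest π F) - Λ k n (σ ∘ π) F) atTop (𝓝 0)) ∧
        (∀ (N : ℕ) (deg : Fin N → ℕ) (lab : (j : Fin N) → Fin (deg j) → QCDField Nf)
          (F : (j : Fin N) → 𝓢((Fin (deg j) → (EuclideanSpace ℝ (Fin 4))), ℂ)), (∀ j, IsTimeOrdered (F j)) →
          ∀ H : (i j : Fin N) → 𝓢((Fin (deg i + deg j) → (EuclideanSpace ℝ (Fin 4))), ℂ),
            (∀ i j, IsAppendTensorOf (H i j) (osAdjoint (F i)) (F j)) →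
            ∀ ε : ℝ, 0 < ε → ∀ᶠ l in atTop,
              -ε ≤ (∑ i, ∑ j, Λ l (deg i + deg j) (Fin.append (lab i ∘ Fin.rev) (lab j)) (H i j)).re ∧
              |(∑ i, ∑ j, Λ l (deg i + deg j) (Fin.append (lab i ∘ Fin.rev) (lab j)) (H i j)).im| ≤ ε) ∧
        (∀ (n m : ℕ) (σ : Fin n → QCDField Nf) (σ' : Fin m → QCDField Nf) (F : 𝓢((Fin n → (EuclideanSpace ℝ (Fin 4))), ℂ))
          (G : 𝓢((Fin m → (EuclideanSpace ℝ (Fin 4))), ℂ)), IsTimeOrdered F → IsTimeOrdered G → ∀ a : (EuclideanSpace ℝ (Fin 4)), a 0 = 0 → a ≠ 0 →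
          ∀ ε : ℝ, 0 < ε → ∃ t₀ : ℝ, ∀ t : ℝ, t₀ ≤ t → ∀ H : 𝓢((Fin (n + m) → (EuclideanSpace ℝ (Fin 4))), ℂ),
            IsAppendTensorOf H (osAdjoint F) (translateMulti (t • a) G) →
            ∀ᶠ k in atTop, ‖Λ k (n + m) (Fin.append (σ ∘ Fin.rev) σ') H -
              Λ k n (σ ∘ Fin.rev) (osAdjoint F) * Λ k m σ' G‖ ≤ ε) ∧
        (∃ Δ : ℝ, 0 < Δ ∧ ClustersCS 4 (fun k n σ f => Λ k n σ (SchwartzMap.tensorFin n fun i => ofRealTest (f i))) Δ ∧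
          (reg.scheme m z shift).HasLatticeMassGap Δ) ∧
        (∃ (F G : 𝓢((Fin 1 → (EuclideanSpace ℝ (Fin 4))), ℂ)) (H : 𝓢((Fin (1 + 1) → (EuclideanSpace ℝ (Fin 4))), ℂ)),
          IsTimeOrdered F ∧ IsTimeOrdered G ∧ IsAppendTensorOf H (osAdjoint F) G ∧ ∃ ε : ℝ, 0 < ε ∧
            ∀ᶠ k in atTop, ε ≤ ‖Λ k (1 + 1) (fun _ => QCDField.glue) H -
              Λ k 1 (fun _ => QCDField.glue) (osAdjoint F) * Λ k 1 (fun _ => QCDField.glue) G‖) ∧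
        (∀ f g : Fin Nf, f ≠ g → ∃ (F G : 𝓢((Fin 1 → (EuclideanSpace ℝ (Fin 4))), ℂ)) (H : 𝓢((Fin (1 + 1) → (EuclideanSpace ℝ (Fin 4))), ℂ)),
          IsTimeOrdered F ∧ IsTimeOrdered G ∧ IsAppendTensorOf H (osAdjoint F) G ∧ ∃ ε : ℝ, 0 < ε ∧
            ∀ᶠ k in atTop, ε ≤ ‖Λ k (1 + 1) (fun _ => QCDField.pseudoRe f g) H -
              Λ k 1 (fun _ => QCDField.pseudoRe f g) (osAdjoint F) *
                Λ k 1 (fun _ => QCDField.pseudoRe f g) G‖) ∧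
        (∃ (f g h : 𝓢(EuclideanSpace ℝ (Fin 4), ℂ)) (Ffgh : 𝓢((Fin 3 → (EuclideanSpace ℝ (Fin 4))), ℂ)) (Fgh Ffh Ffg : 𝓢((Fin 2 → (EuclideanSpace ℝ (Fin 4))), ℂ))
          (Ff Fg Fh : 𝓢((Fin 1 → (EuclideanSpace ℝ (Fin 4))), ℂ)),
          IsTensorOf Ffgh ![f, g, h] ∧ IsOffDiagonal Ffgh ∧ IsTensorOf Fgh ![g, h] ∧ IsTensorOf Ffh ![f, h] ∧
          IsTensorOf Ffg ![f, g] ∧ IsOffDiagonal Fgh ∧ IsOffDiagonal Ffh ∧ IsOffDiagonal Ffg ∧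
          IsTensorOf Ff ![f] ∧ IsTensorOf Fg ![g] ∧ IsTensorOf Fh ![h] ∧ ∃ ε : ℝ, 0 < ε ∧
            ∀ᶠ k in atTop, ε ≤ ‖Λ k 3 (fun _ => QCDField.glue) Ffgh
              - Λ k 1 (fun _ => QCDField.glue) Ff * Λ k 2 (fun _ => QCDField.glue) Fgh
              - Λ k 1 (fun _ => QCDField.glue) Fg * Λ k 2 (fun _ => QCDField.glue) Ffh
              - Λ k 1 (fun _ => QCDField.glue) Fh * Λ k 2 (fun _ => QCDField.glue) Ffg
              + 2 * (Λ k 1 (fun _ => QCDField.glue) Ff * Λ k 1 (fun _ => QCDField.glue) Fg *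
                  Λ k 1 (fun _ => QCDField.glue) Fh)‖)) →
    (∀ sch : QCDScheme Nf, sch.HasAsymptoticScaling →
      (∀ fl : Fin Nf, ∀ᶠ k in atTop, -1 < sch.mq fl k) → (∃ Δ : ℝ, 0 < Δ ∧ sch.HasLatticeMassGap Δ) →
      ∀ S : LabelledSchwingerFamily (QCDField Nf) (EuclideanSpace ℝ (Fin 4)),
        (∀ n : ℕ, n ≠ 0 → ∀ (σ : Fin n → QCDField Nf) (f : Fin n → 𝓢(EuclideanSpace ℝ (Fin 4), ℝ)) (F : 𝓢((Fin n → (EuclideanSpace ℝ (Fin 4))), ℂ)),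
          IsTensorOf F (fun i => ofRealTest (f i)) → IsOffDiagonal F →
          Tendsto (fun k => qcdLatticeSchwinger sch k n σ f) atTop (𝓝 (S n σ F))) →
        ∀ (n : ℕ) (σ : Fin n → QCDField Nf) (R : (EuclideanSpace ℝ (Fin 4)) ≃ₗᵢ[ℝ] (EuclideanSpace ℝ (Fin 4))),
          LinearMap.det (R.toLinearEquiv : (EuclideanSpace ℝ (Fin 4)) →ₗ[ℝ] (EuclideanSpace ℝ (Fin 4))) = 1 →
          ∀ F : 𝓢((Fin n → (EuclideanSpace ℝ (Fin 4))), ℂ), IsOffDiagonal F → S n σ (linActMulti R F) = S n σ F) →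
    QCDOf Nf := by
  intro Nf hpkg hrot
  obtain ⟨reg, hms, hχ, hall⟩ := hpkg
  refine ⟨reg, hms, hχ, fun m hm => ?_⟩
  obtain ⟨z, shift, Λ, hagree, hAS, hbr, ⟨s, α, β, hα, hbound⟩, hconv, hnorm, htrans, hsymm, hrp, hcl,
    ⟨Δ, hΔ, hCS, hgap⟩, hglue, hpseudo, hκ₃⟩ := hall m hm
  obtain ⟨T, hQCD, hnt, hng, hps, hTgap, hLgap⟩ :=
    exists_osData_qcd_of_asymptoticPackage (reg.scheme m z shift) Λ hagree hAS hbr hα hbound hconv hnorm htrans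
      hsymm hrp hcl hCS hgap hglue hpseudo hκ₃ (hrot (reg.scheme m z shift) hAS hbr ⟨Δ, hΔ, hgap⟩)
  exact ⟨z, shift, T, hQCD, hnt, hng, hps, Δ, hΔ, hTgap, hLgap⟩

end Summit.QuantumFields.QCD.Cruxes.StableActionBridge.Sketch

end
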